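import Literature.Geometry.Riemannian.LevelSetMeanCurvature
import HarnessLib

/-!
# Divergence along an immersion into Euclidean space (the first-variation integrand)

For a map `f : N → V` of a manifold into a real inner product space which is a spacelike
(= Riemannian) immersion for the Euclidean metric (`IsSpacelikeImmersion`, `Hypersurface.lean`) and
a `V`-valued field `W : N → V` along `f`, the **divergence of `W` along `f`** is the metric trace,
for the induced metric `f^*δ`, of the bilinear form `(v, w) ↦ ⟪dW_y v, df_y w⟫` on `T_y N`; in an
`f^*δ`-orthonormal frame `(bᵢ)` it is `Σᵢ ⟪dW bᵢ, df bᵢ⟫`.  Two instances: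

* `W = X ∘ f` for an ambient vector field `X`: `divAlong f (X ∘ f) = Σᵢ ⟪DX(Eᵢ), Eᵢ⟫`
  (`Eᵢ = df bᵢ` an orthonormal frame of the tangent plane `df(T_y N)`), the **tangential
  divergence** `div_{f(N)} X`, i.e. the integrand of the **first variation**
  `δV(X) = ∫ div_S X(x) dV(x, S)` of the varifold `V = v(f(N))` (Allard 1972, §4.1–4.2; Simon 1983,
  §16, (16.2) and §38–39);
* `W = ν` a unit normal field: `divAlong f ν = tr_{f^*δ} K_ν`, the tree's `meanCurvature`
  (`meanCurvature_eq_divAlong`, proved in the sibling proof file of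
  `AllardIntegralDensityOfLimits.lean`).

This file holds the two DEFINITIONS (`derivPairing`, `divAlong`, with bodies) and their algebraic
API (frame formula, additivity, Leibniz rule for normal fields); it introduces no named facts.
It is groundwork for the first-variation bound `‖δ v(ι_k M)‖(ℝ⁶) ≤ ∫ (|H_k| + 4)` in the proof of
`Literature.Geometry.GeometricMeasureTheory.Allard1972_integralDensityOfLimits_cylinderCrossSections`.

## References

* W. K. Allard, *On the first variation of a varifold*, Ann. of Math. 95 (1972) 417–491, §4.1–4.2.
  [Allard1972]
* L. Simon, *Lectures on Geometric Measure Theory*, ANU 1983, §7 (7.5)–(7.6) (divergence on a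
  submanifold, `div_M X = Σ ⟪D_{τᵢ} X, τᵢ⟫`), §16 (16.2), §39 (39.2). [Simon1983]
-/

noncomputable section

open Bundle Set Function Module
open scoped Manifold ContDiff Topology RealInnerProductSpace

namespace Literature.Geometry.GeometricMeasureTheory

open Literature.Geometry.Riemannian Literature.Geometry.Lorentzian
  Literature.Geometry.Lorentzian.PseudoRiemannianMetric

variable {V : Type*} [NormedAddCommGroup V] [InnerProductSpace ℝ V]
  {E' : Type*} [NormedAddCommGroup E'] [NormedSpace ℝ E'] {H' : Type*} [TopologicalSpace H']
  (I' : ModelWithCorners ℝ E' H') {N : Type*} [TopologicalSpace N] [ChartedSpace H' N]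

/-- The bilinear form `(v, w) ↦ ⟪dW_y v, df_y w⟫` on `T_y N`, for maps `f, W : N → V` into a real
inner product space (`mvfderiv`, the vector-valued manifold derivative). Simon 1983, §7, (7.5):
the summands `⟪D_{τ} X, τ⟫` of the divergence on a submanifold. [cite: Simon1983, §7 (7.5)] -/
def derivPairing (f W : N → V) (y : N) : LinearMap.BilinForm ℝ (TangentSpace I' y) :=
  LinearMap.mk₂ ℝ (fun v w => ⟪mvfderiv I' W y v, mvfderiv I' f y w⟫)
    (fun v₁ v₂ w => by simp only [map_add, inner_add_left])
    (fun c v w => by simp only [map_smul, real_inner_smul_left, smul_eq_mul])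
    (fun v w₁ w₂ => by simp only [map_add, inner_add_right])
    (fun c v w => by simp only [map_smul, real_inner_smul_right, smul_eq_mul])

/-- `derivPairing f W y v w = ⟪dW_y v, df_y w⟫`. [cite: Simon1983, §7 (7.5)] -/
@[simp]
theorem derivPairing_apply (f W : N → V) (y : N) (v w : TangentSpace I' y) :
    derivPairing I' f W y v w = ⟪mvfderiv I' W y v, mvfderiv I' f y w⟫ :=
  rfl

/-- Additivity of the pairing in the field: `⟪d(W₁ + W₂) v, df w⟫ = ⟪dW₁ v, df w⟫ + ⟪dW₂ v, df w⟫`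
for `W₁, W₂` differentiable at `y`. [folklore] -/
theorem derivPairing_add (f : N → V) {W₁ W₂ : N → V} {y : N}
    (h₁ : MDifferentiableAt I' 𝓘(ℝ, V) W₁ y) (h₂ : MDifferentiableAt I' 𝓘(ℝ, V) W₂ y) :
    derivPairing I' f (W₁ + W₂) y = derivPairing I' f W₁ y + derivPairing I' f W₂ y := by
  ext v w
  simp only [derivPairing_apply, LinearMap.add_apply, mvfderiv_add h₁ h₂,
    _root_.add_apply, inner_add_left]

/-- Leibniz rule for the pairing: `⟪d(φ W) v, df w⟫ = φ ⟪dW v, df w⟫ + dφ(v) ⟪W, df w⟫` for a scalar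
`φ` and a field `W` differentiable at `y`. [folklore] -/
theorem derivPairing_smul (f : N → V) {φ : N → ℝ} {W : N → V} {y : N}
    (hφ : MDifferentiableAt I' 𝓘(ℝ, ℝ) φ y) (hW : MDifferentiableAt I' 𝓘(ℝ, V) W y)
    (v w : TangentSpace I' y) :
    derivPairing I' f (φ • W) y v w =
      φ y * derivPairing I' f W y v w + mvfderiv I' φ y v * ⟪W y, mvfderiv I' f y w⟫ := by
  simp only [derivPairing_apply, mvfderiv_smul hφ hW, _root_.add_apply,
    _root_.smul_apply, ContinuousLinearMap.smulRight_apply, inner_add_left,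
    real_inner_smul_left]

variable {I'} [FiniteDimensional ℝ E'] [IsManifold I' ∞ N]

/-- **Divergence of a `V`-valued field `W` along a spacelike immersion `f : N → V`** into a
Euclidean space: the metric trace, for the induced metric `f^*δ`, of `(v, w) ↦ ⟪dW_y v, df_y w⟫`;
`= Σᵢ ⟪dW bᵢ, df bᵢ⟫` in an `f^*δ`-orthonormal frame (`divAlong_eq_sum`).  For `W = X ∘ f` this is
the tangential divergence `div_{f(N)} X`, the integrand of the first variation of the varifold
`v(f(N))` (Allard 1972, §4.2; Simon 1983, §16 (16.2), §39 (39.2)); for `W = ν` a unit normal it is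
the mean curvature `tr_{f^*δ} K_ν`. [cite: Allard1972, §4.2] -/
def divAlong (hpb : contMDiff_pullbackBilin 𝓘(ℝ, V) V I' N ∞) {f : N → V}
    (hf : (euclideanMetric V).IsSpacelikeImmersion I' f) (W : N → V) (y : N) : ℝ :=
  ((euclideanMetric V).inducedMetric f hpb hf).trace y (derivPairing I' f W y)

section API

variable {hpb : contMDiff_pullbackBilin 𝓘(ℝ, V) V I' N ∞} {f : N → V}
  {hf : (euclideanMetric V).IsSpacelikeImmersion I' f}

/-- Unfolding lemma. [folklore] -/
theorem divAlong_def (W : N → V) (y : N) :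
    divAlong hpb hf W y = ((euclideanMetric V).inducedMetric f hpb hf).trace y (derivPairing I' f W y) :=
  rfl

/-- The induced metric on tangent vectors: `(f^*δ)_y(v, w) = ⟪df v, df w⟫`. [folklore] -/
theorem inducedMetric_euclideanMetric_val (y : N) (v w : TangentSpace I' y) :
    ((euclideanMetric V).inducedMetric f hpb hf).val y v w = ⟪mvfderiv I' f y v, mvfderiv I' f y w⟫ := by
  rw [inducedMetric_val, inducedBilin_apply, euclideanMetric_apply]
  rfl

/-- **Orthonormal frames exist** for the induced metric at every point (`dim N = m`). [folklore] -/
theorem exists_basis_isOrthonormalFrame_inducedMetric (y : N) {m : ℕ} (hm : finrank ℝ E' = m) :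
    ∃ b : Module.Basis (Fin m) ℝ (TangentSpace I' y),
      ((euclideanMetric V).inducedMetric f hpb hf).IsOrthonormalFrame y b :=
  ((euclideanMetric V).inducedMetric f hpb hf).exists_basis_isOrthonormalFrame
    (fun v hv => isRiemannian_inducedMetric _ _ hpb hf y v hv) hm

/-- **Frame formula**: in an `f^*δ`-orthonormal basis `b` of `T_y N`,
`divAlong f W (y) = Σᵢ ⟪dW bᵢ, df bᵢ⟫` (Simon 1983, §7 (7.5): `div_M X = Σᵢ ⟪D_{τᵢ} X, τᵢ⟫`).
[cite: Simon1983, §7 (7.5)] -/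
theorem divAlong_eq_sum {ι : Type*} [Fintype ι] {y : N} (b : Module.Basis ι ℝ (TangentSpace I' y))
    (hb : ((euclideanMetric V).inducedMetric f hpb hf).IsOrthonormalFrame y b) (W : N → V) :
    divAlong hpb hf W y = ∑ i, ⟪mvfderiv I' W y (b i), mvfderiv I' f y (b i)⟫ := by
  rw [divAlong_def, PseudoRiemannianMetric.trace_eq_sum_of_isOrthonormalFrame _ b hb]
  simp only [derivPairing_apply]

/-- The metric trace is additive. [folklore] -/
theorem trace_add' {y : N} (T₁ T₂ : LinearMap.BilinForm ℝ (TangentSpace I' y)) :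
    ((euclideanMetric V).inducedMetric f hpb hf).trace y (T₁ + T₂) =
      ((euclideanMetric V).inducedMetric f hpb hf).trace y T₁ +
        ((euclideanMetric V).inducedMetric f hpb hf).trace y T₂ := by
  simp only [PseudoRiemannianMetric.trace, LinearMap.comp_add, map_add]

/-- **Additivity**: `divAlong f (W₁ + W₂) = divAlong f W₁ + divAlong f W₂` for fields differentiable
at `y`. [folklore] -/
theorem divAlong_add {W₁ W₂ : N → V} {y : N}
    (h₁ : MDifferentiableAt I' 𝓘(ℝ, V) W₁ y) (h₂ : MDifferentiableAt I' 𝓘(ℝ, V) W₂ y) :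
    divAlong hpb hf (W₁ + W₂) y = divAlong hpb hf W₁ y + divAlong hpb hf W₂ y := by
  rw [divAlong_def, derivPairing_add I' f h₁ h₂, trace_add', divAlong_def, divAlong_def]

/-- **Leibniz rule for normal fields**: if `W y ⊥ df_y(T_y N)` then
`divAlong f (φ W) (y) = φ(y) · divAlong f W (y)` (the term `dφ(v) ⟪W, df w⟫` vanishes). Used for the
normal part `⟪X, ν⟫ ν` of an ambient field (Simon 1983, §7 (7.6), §16 (16.3)). [cite: Simon1983, §16 (16.3)] -/
theorem divAlong_smul_of_normal {φ : N → ℝ} {W : N → V} {y : N}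
    (hφ : MDifferentiableAt I' 𝓘(ℝ, ℝ) φ y) (hW : MDifferentiableAt I' 𝓘(ℝ, V) W y)
    (hn : ∀ w : TangentSpace I' y, ⟪W y, mvfderiv I' f y w⟫ = 0) :
    divAlong hpb hf (φ • W) y = φ y * divAlong hpb hf W y := by
  have h : derivPairing I' f (φ • W) y = φ y • derivPairing I' f W y := by
    ext v w
    rw [derivPairing_smul I' f hφ hW, hn w, mul_zero, add_zero, LinearMap.smul_apply,
      LinearMap.smul_apply, smul_eq_mul]
  rw [divAlong_def, h, PseudoRiemannianMetric.trace, LinearMap.comp_smul, map_smul, smul_eq_mul,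
    divAlong_def, PseudoRiemannianMetric.trace]

end API

end Literature.Geometry.GeometricMeasureTheory

end
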